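import Literature.AlgebraicGeometry.Deformation.LocalHilbertFunctorNormalObstructionBaseChange
import Literature.AlgebraicGeometry.Deformation.SmallExtensionKernelQuotient
import HarnessLib

/-!
# Coordinates on the tangent sheaf of the local Hilbert functor: `T_π ≅ 𝒩_{Z/X} ⊗_k J`

For a closed subscheme `ι₀ : Z ↪ X` of a locally Noetherian `k`-scheme and a surjection datum `π : A′ → A` of `Art_k` with
`J = ker π`, `J · 𝔪 = 0` (ANY `dim_k J`), [Hartshorne2010, Thm. 6.2] works with the sheaf `𝒩₀ ⊗_k J` on `Y₀ = Z`; the tree's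
model is the tangent sheaf `T_π : V ↦ H^{X ∖ ι₀(Z ∖ V)}(k[J])` (`hilbTangentSheaf`, `LocalHilbertFunctorTangentSheaf`),
identified with `𝒩_{Z/X}` only for PRINCIPAL `J = k · t` (`hilbTangentNormalIso`). This file supplies the identification
`T_π ≅ 𝒩_{Z/X} ⊗_k J` in the form the obstruction calculus needs — by COORDINATES:

* §1 `T` is a functor of the surjection datum: `T_{β ∘ α} = T_α ≫ T_β` (`hilbTangentSheafMap_comp`), and `T_α = 0` when `α`
  kills `J₁` (`hilbTangentSheafMap_eq_zero_of_map_ker`) — [Hartshorne2010, §11 Definition (b)]'s «natural map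
  `V ⊗ J → V ⊗ J/K`» is functorial;
* §2 the coordinate lines `μ_i = T_{λ_i} : T_ε ⟶ T_π` (`hilbTangentLineMap`; `λ_i : k[ε] → A′`, `a + bε ↦ a + b i`,
  `SmallExtensionKernelQuotient` §6; `T_ε` the tangent sheaf along `k[ε] → k`, `≅ 𝒩_{Z/X}` by `hilbTangentNormalIsoEps`) and the
  probes `ρ_w = T_{q_w} ≫ ψ_w : T_π ⟶ 𝒩_{Z/X}` along the quotients `A′/ker w → A` by hyperplanes of `J`
  (`hilbTangentProbe`); **`μ_i ≫ ρ_w = ψ_ε ≫ (w(i) ·)`** (`hilbTangentLineMap_comp_hilbTangentProbe`) — Schlessinger's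
  «`t_F ⊗ I → F(k[I])` on pure tensors» [Schlessinger1968, (2.17)] read through the base change of `LocalHilbertFunctorNormal
  ObstructionBaseChange`;
* §3 **the lines generate `T_π`**: two morphisms `T_π ⟶ G` agreeing on every `μ_i` are equal (`hilbTangentSheaf.hom_ext_lineMap`;
  sections of `T_π` over `V` are `t ⊗ J` by `ArtinFunctor.kerTensorEquiv` = [Schlessinger1968, Lemma 2.10 / (2.17)]), and
  `i ↦ μ_i` is additive with `μ_{c i} = T_{σ_c} ≫ μ_i` (`hilbTangentLineMap_add/_smul/_sum`);
* §4 for a basis `(b_l)` of `J` with coordinate functionals `b_l^*`: **`ρ_w = Σ_l ρ_{b_l^*} ≫ (w(b_l) ·)`**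
  (`hilbTangentProbe_eq_sum`) and **`Σ_l ρ_{b_l^*} ≫ ψ_ε⁻¹ ≫ μ_{b_l} = 𝟙_{T_π}`** (`sum_hilbTangentProbe_comp_inv_comp_lineMap`):
  the `ρ_{b_l^*}` are the coordinates of an isomorphism `T_π ≅ ⊕_l 𝒩_{Z/X} = 𝒩_{Z/X} ⊗_k J` — Hartshorne's `𝒩₀ ⊗_k J`.

HONEST SCOPE. (1) As the parents: embedded deformations inside the trivial deformation of `X` only; `X` locally Noetherian.
(2) The isomorphism `T_π ≅ 𝒩 ⊗ J` is delivered through its coordinates and the two identities of §4 (what `H¹` consumes), not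
as a bundled `Iso` with a tensor-product sheaf (the tree has no `𝒩 ⊗_k J` sheaf object). (3) Nothing here concerns a
Hodge-type statement; the file feeds the obstruction theory `H¹(Z, 𝒩_{Z/X}) ⊗_k J` of `H_Z^X` (Fantechi–Manetti packaging of
[Hartshorne2010, Thm. 6.2 (b)]).

## References
* [Hartshorne2010] R. Hartshorne, *Deformation Theory*, GTM 257 (2010): Thm. 6.2 pp. 46–49; §11 Definition (b) p. 96.
* [Schlessinger1968] M. Schlessinger, Functors of Artin rings, Trans. AMS 130 (1968): Lemma 2.10, (2.16)–(2.17), pp. 212–213.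
* [Manetti1999DeformationTheoryDGLA] M. Manetti, Deformation theory via differential graded Lie algebras (1999): Def. 2.12.
* [Hartshorne1977] R. Hartshorne, *Algebraic Geometry*, GTM 52 (1977): III Remark 2.6.1 (module structures on cohomology).
-/

noncomputable section

-- `(X ⊗ T).left = pullback X.hom T.hom` is `rfl` (`Over.tensorObj_left`) only at default transparency; as in the parents
set_option backward.isDefEq.respectTransparency false -- `HilbTangentSheafNormalSheafIso.lean` ∕ Mathlib's `Cartesian.Over`

open CategoryTheory Limits MonoidalCategory Opposite TopologicalSpace IsLocalRing _root_.AlgebraicGeometry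
  _root_.AlgebraicGeometry.Scheme.IdealSheafData Literature.AlgebraicGeometry.Motives Literature.AlgebraicGeometry.Modules
open scoped TensorProduct

universe u

namespace Literature.AlgebraicGeometry.Deformation

/-! ## §1 `T` is a functor of the surjection datum -/

section Functor

variable {k : Type u} [Field k] (X : Motives.SchemeOver k) {Z : Scheme.{u}} (ι₀ : Z ⟶ X.left) [IsClosedImmersion ι₀]
  {A'₁ A₁ A'₂ A₂ A'₃ A₃ : ArtAlg.{u} k}
  (π₁ : A'₁ →ₐ[k] A₁) (h₁ : RingHom.ker π₁ * maximalIdeal A'₁ = ⊥) (aug₁ : ↥A'₁ →ₐ[k] k)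
  (π₂ : A'₂ →ₐ[k] A₂) (h₂ : RingHom.ker π₂ * maximalIdeal A'₂ = ⊥) (aug₂ : ↥A'₂ →ₐ[k] k)
  (π₃ : A'₃ →ₐ[k] A₃) (h₃ : RingHom.ker π₃ * maximalIdeal A'₃ = ⊥) (aug₃ : ↥A'₃ →ₐ[k] k)

/-- **`T_{β ∘ α} = T_α ≫ T_β`**: the tangent-sheaf map of a composite of morphisms of surjection data is the composite
(on sections `H^{X ∖ ι₀(Z ∖ V)}` is a functor and `k[J₁ → J₂ → J₃]` composes, `ArtAlg.sqZeroKerMap_comp`).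
[cite: Hartshorne2010, §11 Definition (b)] [cite: Schlessinger1968, (2.16)–(2.17), p. 213] -/
theorem hilbTangentSheafMap_comp (α : ↥A'₁ →ₐ[k] ↥A'₂) (ᾱ : ↥A₁ →ₐ[k] ↥A₂) (hsq : π₂.comp α = ᾱ.comp π₁)
    (hπ₂ : Function.Surjective π₂) (β : ↥A'₂ →ₐ[k] ↥A'₃) (β' : ↥A₂ →ₐ[k] ↥A₃) (hsq' : π₃.comp β = β'.comp π₂)
    (hπ₃ : Function.Surjective π₃) (hsq'' : π₃.comp (β.comp α) = (β'.comp ᾱ).comp π₁) :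
    hilbTangentSheafMap X ι₀ π₁ h₁ aug₁ π₂ h₂ aug₂ α ᾱ hsq hπ₂ ≫ hilbTangentSheafMap X ι₀ π₂ h₂ aug₂ π₃ h₃ aug₃ β β' hsq' hπ₃ =
      hilbTangentSheafMap X ι₀ π₁ h₁ aug₁ π₃ h₃ aug₃ (β.comp α) (β'.comp ᾱ) hsq'' hπ₃ := by
  apply ObjectProperty.hom_ext
  refine NatTrans.ext (funext fun ⟨V⟩ => ?_)
  refine AddCommGrpCat.ext fun s => ?_
  change ((hilbTangentSheafMap X ι₀ π₂ h₂ aug₂ π₃ h₃ aug₃ β β' hsq' hπ₃).hom.app (op V)).hom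
      (((hilbTangentSheafMap X ι₀ π₁ h₁ aug₁ π₂ h₂ aug₂ α ᾱ hsq hπ₂).hom.app (op V)).hom s) =
    ((hilbTangentSheafMap X ι₀ π₁ h₁ aug₁ π₃ h₃ aug₃ (β.comp α) (β'.comp ᾱ) hsq'' hπ₃).hom.app (op V)).hom s
  rw [hilbTangentSheafMap_app_apply, hilbTangentSheafMap_app_apply, hilbTangentSheafMap_app_apply,
    ← ArtAlg.sqZeroKerMap_comp π₁ h₁ π₂ h₂ π₃ h₃ α ᾱ hsq β β' hsq' hsq'', ArtinFunctor.map_comp]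

/-- `T_α` depends only on the maps `α`, `ᾱ` (not on the proof of the square). [cite: Hartshorne2010, §11 Definition (b)] -/
theorem hilbTangentSheafMap_congr {α α' : ↥A'₁ →ₐ[k] ↥A'₂} {ᾱ ᾱ' : ↥A₁ →ₐ[k] ↥A₂} (hsq : π₂.comp α = ᾱ.comp π₁)
    (hsq' : π₂.comp α' = ᾱ'.comp π₁) (hπ₂ : Function.Surjective π₂) (hα : α = α') (hᾱ : ᾱ = ᾱ') :
    hilbTangentSheafMap X ι₀ π₁ h₁ aug₁ π₂ h₂ aug₂ α ᾱ hsq hπ₂ = hilbTangentSheafMap X ι₀ π₁ h₁ aug₁ π₂ h₂ aug₂ α' ᾱ' hsq' hπ₂ := by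
  subst hα hᾱ
  rfl

/-- **`T_α = 0` when `α` kills `J₁`** (then `k[J₁] → k[J₂]` factors through `k`, `ArtAlg.sqZeroKerMap_eq_inl_comp_aug`, and
`H^{X ∖ ι₀(Z ∖ V)}(k) = {pt}` is the zero of Schlessinger's group, `ArtinFunctor.kerZero_eq`). [cite: Hartshorne2010, §11 Definition (b)]
[cite: Schlessinger1968, (2.17), p. 213] -/
theorem hilbTangentSheafMap_eq_zero_of_map_ker (α : ↥A'₁ →ₐ[k] ↥A'₂) (ᾱ : ↥A₁ →ₐ[k] ↥A₂) (hsq : π₂.comp α = ᾱ.comp π₁)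
    (hπ₂ : Function.Surjective π₂) (hα : ∀ j : ↥A'₁, j ∈ RingHom.ker π₁ → α j = 0) :
    hilbTangentSheafMap X ι₀ π₁ h₁ aug₁ π₂ h₂ aug₂ α ᾱ hsq hπ₂ = 0 := by
  apply ObjectProperty.hom_ext
  refine NatTrans.ext (funext fun ⟨V⟩ => ?_)
  refine AddCommGrpCat.ext fun s => ?_
  letI := localHilbertFunctor.kerAddCommGroup (openOver X (satOpen X ι₀ V)) (ι₀.ker.comap (satOpen X ι₀ V).ι) π₂ h₂ aug₂
  change ((hilbTangentSheafMap X ι₀ π₁ h₁ aug₁ π₂ h₂ aug₂ α ᾱ hsq hπ₂).hom.app (op V)).hom s =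
    (0 : (localHilbertFunctor (openOver X (satOpen X ι₀ V)) (ι₀.ker.comap (satOpen X ι₀ V).ι)).obj (ArtAlg.sqZeroKer π₂ h₂))
  rw [hilbTangentSheafMap_app_apply, ArtAlg.sqZeroKerMap_eq_inl_comp_aug π₂ h₂ π₁ h₁ aug₁ α ᾱ hsq hα, ArtinFunctor.map_comp,
    localHilbertFunctor_obj_base_eq_trivialDeformation (openOver X (satOpen X ι₀ V)) (ι₀.ker.comap (satOpen X ι₀ V).ι)
      ((localHilbertFunctor (openOver X (satOpen X ι₀ V)) (ι₀.ker.comap (satOpen X ι₀ V).ι)).map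
        (ArtAlg.sqZeroKerAug π₁ h₁ aug₁) s),
    ArtinFunctor.kerZero_eq _ (localHilbertFunctor.trivialDeformation _ _ (ArtAlg.base k))
      (fun a => localHilbertFunctor_obj_base_eq_trivialDeformation _ _ a)
      (localHilbertFunctor_isBijectiveAlong_sqZeroExtAug (openOver X (satOpen X ι₀ V)) (ι₀.ker.comap (satOpen X ι₀ V).ι) k)
      π₂ h₂ aug₂]

end Functor

/-! ## §2 The reference sheaf `T_ε`, the coordinate lines `μ_i`, the scalings `T_{σ_c}`, the probes `ρ_w` -/

section Lines

variable {k : Type u} [Field k] (X : Motives.SchemeOver k) {Z : Scheme.{u}} (ι₀ : Z ⟶ X.left) [IsClosedImmersion ι₀]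

/-- **The reference tangent sheaf `T_ε`** of `H_Z^X`: the tangent sheaf along the small extension `k[ε] → k` (`J₀ = k · ε`),
`V ↦ H^{X ∖ ι₀(Z ∖ V)}(k[J₀])`. Definition with body (abbreviation). [cite: Hartshorne2010, Thm. 2.4 with Thm. 6.2 (a), pp. 12–13, 47]
[cite: Schlessinger1968, Lemma 2.10, p. 212] -/
abbrev hilbTangentSheafEps : Sheaf (Opens.grothendieckTopology Z) AddCommGrpCat.{u} :=
  hilbTangentSheaf X ι₀ (ArtAlg.sqZeroExtAug (k := k) k) (ArtAlg.ker_sqZeroExtAug_mul_maximalIdeal k)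
    (ArtAlg.sqZeroExt (k := k) k).residue

variable [IsLocallyNoetherian X.left]

/-- **`ψ_ε : T_ε ≅ 𝒩_{Z/X}`** along the generator `ε` of `J₀` (`hilbTangentNormalIso`). Definition with body (abbreviation).
[cite: Hartshorne2010, Thm. 2.4 with Thm. 6.2 (a), pp. 12–13, 47] -/
abbrev hilbTangentNormalIsoEps : hilbTangentSheafEps X ι₀ ≅ normalSheafAb ι₀ :=
  hilbTangentNormalIso X ι₀ (ArtAlg.sqZeroExtAug (k := k) k) (ArtAlg.ker_sqZeroExtAug_mul_maximalIdeal k)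
    (ArtAlg.sqZeroExt (k := k) k).residue (ArtAlg.epsKer k) (ArtAlg.epsKer_ne_zero k) (ArtAlg.exists_eq_smul_epsKer k)

omit [IsLocallyNoetherian X.left] in
/-- **The scaling `T_{σ_c} : T_ε ⟶ T_ε`** along `σ_c : ε ↦ c ε` (Schlessinger's scalar multiplication by `c` on `t ⊗ J₀`).
Definition with body (abbreviation). [cite: Schlessinger1968, Lemma 2.10, p. 212] -/
abbrev hilbTangentEpsScale (c : k) : hilbTangentSheafEps X ι₀ ⟶ hilbTangentSheafEps X ι₀ :=
  hilbTangentSheafMap X ι₀ (ArtAlg.sqZeroExtAug (k := k) k) (ArtAlg.ker_sqZeroExtAug_mul_maximalIdeal k)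
    (ArtAlg.sqZeroExt (k := k) k).residue (ArtAlg.sqZeroExtAug (k := k) k) (ArtAlg.ker_sqZeroExtAug_mul_maximalIdeal k)
    (ArtAlg.sqZeroExt (k := k) k).residue (ArtAlg.epsScale c) (AlgHom.id k (ArtAlg.base k : Type u)) (ArtAlg.epsScale_sq c)
    (ArtAlg.sqZeroExtAug_surjective k)

/-- **`T_{σ_c} ≫ ψ_ε = ψ_ε ≫ (c ·)`**: the scaling of `T_ε` is the homothety `c` of `𝒩_{Z/X}` (base change of
`LocalHilbertFunctorNormalObstructionBaseChange` along `σ_c ε = c · ε`). [cite: Schlessinger1968, Lemma 2.10, p. 212]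
[cite: Hartshorne2010, Thm. 6.2 (a) proof, p. 47] -/
theorem hilbTangentEpsScale_comp_hom (c : k) :
    hilbTangentEpsScale X ι₀ c ≫ (hilbTangentNormalIsoEps X ι₀).hom =
      (hilbTangentNormalIsoEps X ι₀).hom ≫ normalSheafAbScalar ι₀ (subschemeScalar X ι₀ c) :=
  hilbTangentSheafMap_comp_hilbTangentNormalIso_hom X ι₀ _ _ _ (ArtAlg.epsKer k) (ArtAlg.epsKer_ne_zero k)
    (ArtAlg.exists_eq_smul_epsKer k) _ _ _ (ArtAlg.epsKer k) (ArtAlg.epsKer_ne_zero k) (ArtAlg.exists_eq_smul_epsKer k)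
    (ArtAlg.epsScale c) (AlgHom.id k (ArtAlg.base k : Type u)) (ArtAlg.epsScale_sq c) (ArtAlg.sqZeroExtAug_surjective k) c
    (ArtAlg.epsScale_eps c)

/-- `ψ_ε ≫ (c ·) ≫ ψ_ε⁻¹ = T_{σ_c}`. [cite: Schlessinger1968, Lemma 2.10, p. 212] -/
theorem hilbTangentNormalIsoEps_hom_comp_scalar_comp_inv (c : k) :
    (hilbTangentNormalIsoEps X ι₀).hom ≫ normalSheafAbScalar ι₀ (subschemeScalar X ι₀ c) ≫ (hilbTangentNormalIsoEps X ι₀).inv =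
      hilbTangentEpsScale X ι₀ c := by
  rw [← Category.assoc, ← hilbTangentEpsScale_comp_hom, Category.assoc, Iso.hom_inv_id, Category.comp_id]

variable {A' A : ArtAlg.{u} k} (π : A' →ₐ[k] A) (hI : RingHom.ker π * maximalIdeal A' = ⊥) (aug : ↥A' →ₐ[k] k)
  (hπ : Function.Surjective π)

omit [IsLocallyNoetherian X.left] in
/-- **The coordinate line `μ_i = T_{λ_i} : T_ε ⟶ T_π` through `i ∈ J = ker π`** (`λ_i : k[ε] → A′`, `a + bε ↦ a + b i`, over
`k → A`). On sections it is Schlessinger's `v ↦ F(a + bε ↦ a + b i) v`, i.e. `v ⊗ i` under `t ⊗ J ≅ F(k[J])`. Definition with body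
(abbreviation). [cite: Schlessinger1968, (2.17), p. 213 («we identify `V` with `Hom(k[ε], k[V])`»)] -/
abbrev hilbTangentLineMap (i : ↥(ArtAlg.kerSubmodule π)) : hilbTangentSheafEps X ι₀ ⟶ hilbTangentSheaf X ι₀ π hI aug :=
  hilbTangentSheafMap X ι₀ (ArtAlg.sqZeroExtAug (k := k) k) (ArtAlg.ker_sqZeroExtAug_mul_maximalIdeal k)
    (ArtAlg.sqZeroExt (k := k) k).residue π hI aug (ArtAlg.kerLineHom π hI i) (ArtAlg.ofBase A) (ArtAlg.kerLineHom_sq π hI i) hπ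

omit [IsLocallyNoetherian X.left] in
/-- On sections over `V`, `μ_i` takes `H(ε ↦ ε) v` to `H(a + bε ↦ a + b i) v` — the pure tensor `v ⊗ i`.
[cite: Schlessinger1968, (2.17), p. 213] -/
theorem hilbTangentLineMap_app_map_sqZeroKerLine (i : ↥(ArtAlg.kerSubmodule π)) (V : Z.Opens)
    (v : (localHilbertFunctor (openOver X (satOpen X ι₀ V)) (ι₀.ker.comap (satOpen X ι₀ V).ι)).obj (ArtAlg.sqZeroExt (k := k) k)) :
    ((hilbTangentLineMap X ι₀ π hI aug hπ i).hom.app (op V)).hom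
        ((localHilbertFunctor (openOver X (satOpen X ι₀ V)) (ι₀.ker.comap (satOpen X ι₀ V).ι)).map
          (R := ArtAlg.sqZeroExt (k := k) k)
          (S := ArtAlg.sqZeroKer (ArtAlg.sqZeroExtAug (k := k) k) (ArtAlg.ker_sqZeroExtAug_mul_maximalIdeal k))
          (ArtAlg.sqZeroKerLine (ArtAlg.sqZeroExtAug (k := k) k) (ArtAlg.ker_sqZeroExtAug_mul_maximalIdeal k) (ArtAlg.epsKer k))
          v) =
      (localHilbertFunctor (openOver X (satOpen X ι₀ V)) (ι₀.ker.comap (satOpen X ι₀ V).ι)).map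
        (R := ArtAlg.sqZeroExt (k := k) k) (S := ArtAlg.sqZeroKer π hI) (ArtAlg.sqZeroKerLine π hI i) v := by
  rw [hilbTangentSheafMap_app_apply, ← ArtinFunctor.map_comp, ArtAlg.sqZeroKerMap_kerLineHom_comp_sqZeroKerLine_epsKer]

omit [IsLocallyNoetherian X.left] in
/-- **`μ_{c i} = T_{σ_c} ≫ μ_i`** (`λ_i ∘ σ_c = λ_{c i}`). [cite: Schlessinger1968, Lemma 2.10 and (2.17), pp. 212–213] -/
theorem hilbTangentLineMap_smul (c : k) (i : ↥(ArtAlg.kerSubmodule π)) :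
    hilbTangentLineMap X ι₀ π hI aug hπ (c • i) = hilbTangentEpsScale X ι₀ c ≫ hilbTangentLineMap X ι₀ π hI aug hπ i := by
  rw [hilbTangentSheafMap_comp X ι₀ _ _ _ _ _ _ π hI aug (ArtAlg.epsScale c) (AlgHom.id k (ArtAlg.base k : Type u))
    (ArtAlg.epsScale_sq c) (ArtAlg.sqZeroExtAug_surjective k) (ArtAlg.kerLineHom π hI i) (ArtAlg.ofBase A)
    (ArtAlg.kerLineHom_sq π hI i) hπ
    (ArtAlg.comp_sq _ _ (ArtAlg.epsScale c) (AlgHom.id k (ArtAlg.base k : Type u)) (ArtAlg.epsScale_sq c) π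
      (ArtAlg.kerLineHom π hI i) (ArtAlg.ofBase A) (ArtAlg.kerLineHom_sq π hI i))]
  exact hilbTangentSheafMap_congr X ι₀ _ _ _ π hI aug _ _ hπ (ArtAlg.kerLineHom_comp_epsScale π hI i c).symm
    (AlgHom.comp_id _).symm

variable (w : ↥(ArtAlg.kerSubmodule π) →ₗ[k] k) (t : ↥(ArtAlg.kerSubmodule π)) (ht : w t = 1)

/-- **The probe `ρ_w = T_{q_w} ≫ ψ_w : T_π ⟶ 𝒩_{Z/X}`** along the quotient `q_w : A′ → A′/ker w` (a morphism of surjection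
data onto the PRINCIPAL small extension `A′/ker w → A`, generator `t̄`, `w t = 1`) followed by the identification of the
principal tangent sheaf with `𝒩_{Z/X}` along `t̄`: the coordinate «`V ⊗ J → V ⊗ J/K`» of [Hartshorne2010, §11 Definition (b)],
`K = ker w`. Definition with body (abbreviation). [cite: Hartshorne2010, §11 Definition (b), p. 96, with Thm. 6.2 (a) p. 47] -/
abbrev hilbTangentProbe : hilbTangentSheaf X ι₀ π hI aug ⟶ normalSheafAb ι₀ :=
  hilbTangentSheafMap X ι₀ π hI aug (ArtAlg.fnlQuotLift π hI w)
      (ArtAlg.ker_kerQuotLift_mul_maximalIdeal π hI (ArtAlg.fnlKer π w) (ArtAlg.fnlKer_le π w))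
      (ArtAlg.fnlQuot π hI w).residue (ArtAlg.fnlQuotMk π hI w) (AlgHom.id k ↥A) (ArtAlg.kerQuot_sq π hI _ _)
      (ArtAlg.kerQuotLift_surjective π hI _ _ hπ) ≫
    (hilbTangentNormalIso X ι₀ (ArtAlg.fnlQuotLift π hI w)
      (ArtAlg.ker_kerQuotLift_mul_maximalIdeal π hI (ArtAlg.fnlKer π w) (ArtAlg.fnlKer_le π w))
      (ArtAlg.fnlQuot π hI w).residue (ArtAlg.fnlGen π hI w t) (ArtAlg.fnlGen_ne_zero π hI w t ht)
      (ArtAlg.exists_eq_smul_fnlGen π hI w t ht)).hom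

include ht in
/-- **`μ_i ≫ ρ_w = ψ_ε ≫ (w(i) ·)`**: the probe `ρ_w` reads the line through `i` as the scalar `w(i)` — the composite
`k[ε] → A′ → A′/ker w` sends `ε ↦ w(i) · t̄` (`ArtAlg.fnlQuotMk_comp_kerLineHom_eps`), so the base change
`hilbTangentSheafMap_comp_hilbTangentNormalIso_hom` applies with `c = w(i)`. [cite: Hartshorne2010, §11 Definition (b) with Thm. 6.2 (a)]
[cite: Schlessinger1968, (2.17), p. 213] -/
theorem hilbTangentLineMap_comp_hilbTangentProbe (i : ↥(ArtAlg.kerSubmodule π)) :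
    hilbTangentLineMap X ι₀ π hI aug hπ i ≫ hilbTangentProbe X ι₀ π hI aug hπ w t ht =
      (hilbTangentNormalIsoEps X ι₀).hom ≫ normalSheafAbScalar ι₀ (subschemeScalar X ι₀ (w i)) := by
  rw [← Category.assoc, hilbTangentSheafMap_comp X ι₀ _ _ _ π hI aug _ _ _ (ArtAlg.kerLineHom π hI i) (ArtAlg.ofBase A)
    (ArtAlg.kerLineHom_sq π hI i) hπ (ArtAlg.fnlQuotMk π hI w) (AlgHom.id k ↥A) (ArtAlg.kerQuot_sq π hI _ _)
    (ArtAlg.kerQuotLift_surjective π hI _ _ hπ) (ArtAlg.fnlQuotLift_comp_fnlQuotMk_comp_kerLineHom π hI w i)]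
  exact hilbTangentSheafMap_comp_hilbTangentNormalIso_hom X ι₀ _ _ _ (ArtAlg.epsKer k) (ArtAlg.epsKer_ne_zero k)
    (ArtAlg.exists_eq_smul_epsKer k) _ _ _ (ArtAlg.fnlGen π hI w t) (ArtAlg.fnlGen_ne_zero π hI w t ht)
    (ArtAlg.exists_eq_smul_fnlGen π hI w t ht) ((ArtAlg.fnlQuotMk π hI w).comp (ArtAlg.kerLineHom π hI i))
    ((AlgHom.id k ↥A).comp (ArtAlg.ofBase A)) (ArtAlg.fnlQuotLift_comp_fnlQuotMk_comp_kerLineHom π hI w i)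
    (ArtAlg.kerQuotLift_surjective π hI _ _ hπ) (w i) (ArtAlg.fnlQuotMk_comp_kerLineHom_eps π hI w t ht i)

end Lines

/-! ## §3 The lines generate `T_π`; additivity of `i ↦ μ_i` -/

section Generate

variable {k : Type u} [Field k] (X : Motives.SchemeOver k) {Z : Scheme.{u}} (ι₀ : Z ⟶ X.left) [IsClosedImmersion ι₀]
  {A' A : ArtAlg.{u} k} (π : A' →ₐ[k] A) (hI : RingHom.ker π * maximalIdeal A' = ⊥) (aug : ↥A' →ₐ[k] k)
  (hπ : Function.Surjective π)

/-- **The coordinate lines generate `T_π`: two morphisms `T_π ⟶ G` that agree on every `μ_i`, `i ∈ J`, are equal.** Over each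
open `V` the sections of `T_π` are `t ⊗ J ≅ H^{X ∖ ι₀(Z ∖ V)}(k[J])` (`ArtinFunctor.kerTensorEquiv`, bijective under (H₂) and
`H(k) = pt` — both in the tree for the local Hilbert functor of the open piece), and a pure tensor `v ⊗ i` IS `μ_i(H(ε ↦ ε) v)`.
[cite: Schlessinger1968, Lemma 2.10 and (2.17), pp. 212–213] [cite: Hartshorne2010, Thm. 6.2 (a), p. 47 («`𝒩₀ ⊗_k J`»)] -/
theorem hilbTangentSheaf.hom_ext_lineMap {G : Sheaf (Opens.grothendieckTopology Z) AddCommGrpCat.{u}}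
    {φ ψ : hilbTangentSheaf X ι₀ π hI aug ⟶ G}
    (h : ∀ i : ↥(ArtAlg.kerSubmodule π),
      hilbTangentLineMap X ι₀ π hI aug hπ i ≫ φ = hilbTangentLineMap X ι₀ π hI aug hπ i ≫ ψ) : φ = ψ := by
  apply ObjectProperty.hom_ext
  refine NatTrans.ext (funext fun ⟨V⟩ => ?_)
  refine AddCommGrpCat.ext fun s => ?_
  change (φ.hom.app (op V)).hom s = (ψ.hom.app (op V)).hom s
  haveI : Module.Finite k ↥A' := A'.moduleFinite
  let F := localHilbertFunctor (openOver X (satOpen X ι₀ V)) (ι₀.ker.comap (satOpen X ι₀ V).ι)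
  have hpt : ∀ a, a = localHilbertFunctor.trivialDeformation (openOver X (satOpen X ι₀ V)) (ι₀.ker.comap (satOpen X ι₀ V).ι)
      (ArtAlg.base k) := fun a => localHilbertFunctor_obj_base_eq_trivialDeformation _ _ a
  have h2 := localHilbertFunctor_isBijectiveAlong_sqZeroExtAug (openOver X (satOpen X ι₀ V)) (ι₀.ker.comap (satOpen X ι₀ V).ι) k
  letI := F.tangentAddCommGroup _ hpt k h2
  letI := F.tangentModule _ hpt k h2
  letI := localHilbertFunctor.kerAddCommGroup (openOver X (satOpen X ι₀ V)) (ι₀.ker.comap (satOpen X ι₀ V).ι) π hI aug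
  obtain ⟨τ, rfl⟩ := (F.kerTensorEquiv _ hpt h2 π hI aug).surjective s
  induction τ using TensorProduct.induction_on with
  | zero => rw [map_zero, map_zero, map_zero]
  | add x y hx hy => rw [map_add, map_add, map_add, hx, hy]
  | tmul v i =>
    rw [ArtinFunctor.kerTensorEquiv_tmul, ← hilbTangentLineMap_app_map_sqZeroKerLine X ι₀ π hI aug hπ i V v]
    have hi := h i
    change ((hilbTangentLineMap X ι₀ π hI aug hπ i ≫ φ).hom.app (op V)).hom _ =
      ((hilbTangentLineMap X ι₀ π hI aug hπ i ≫ ψ).hom.app (op V)).hom _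
    rw [hi]

/-- **`μ_{i + i′} = μ_i + μ_{i′}`**: additivity of the line in `i` (bilinearity of Schlessinger's `t ⊗ J → F(k[J])`,
`ArtinFunctor.kerTensorEquiv` is additive and `v ⊗ (i + i′) = v ⊗ i + v ⊗ i′`). [cite: Schlessinger1968, Lemma 2.10 and (2.17), pp. 212–213] -/
theorem hilbTangentLineMap_add (i i' : ↥(ArtAlg.kerSubmodule π)) :
    hilbTangentLineMap X ι₀ π hI aug hπ (i + i') = hilbTangentLineMap X ι₀ π hI aug hπ i + hilbTangentLineMap X ι₀ π hI aug hπ i' := by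
  apply ObjectProperty.hom_ext
  refine NatTrans.ext (funext fun ⟨V⟩ => ?_)
  refine AddCommGrpCat.ext fun s => ?_
  haveI : Module.Finite k ↥A' := A'.moduleFinite
  let F := localHilbertFunctor (openOver X (satOpen X ι₀ V)) (ι₀.ker.comap (satOpen X ι₀ V).ι)
  have hpt : ∀ a, a = localHilbertFunctor.trivialDeformation (openOver X (satOpen X ι₀ V)) (ι₀.ker.comap (satOpen X ι₀ V).ι)
      (ArtAlg.base k) := fun a => localHilbertFunctor_obj_base_eq_trivialDeformation _ _ a
  have h2 := localHilbertFunctor_isBijectiveAlong_sqZeroExtAug (openOver X (satOpen X ι₀ V)) (ι₀.ker.comap (satOpen X ι₀ V).ι) k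
  letI := F.tangentAddCommGroup _ hpt k h2
  letI := F.tangentModule _ hpt k h2
  letI := localHilbertFunctor.kerAddCommGroup (openOver X (satOpen X ι₀ V)) (ι₀.ker.comap (satOpen X ι₀ V).ι) π hI aug
  letI := localHilbertFunctor.kerAddCommGroup (openOver X (satOpen X ι₀ V)) (ι₀.ker.comap (satOpen X ι₀ V).ι)
    (ArtAlg.sqZeroExtAug (k := k) k) (ArtAlg.ker_sqZeroExtAug_mul_maximalIdeal k) (ArtAlg.sqZeroExt (k := k) k).residue
  change ((hilbTangentLineMap X ι₀ π hI aug hπ (i + i')).hom.app (op V)).hom s =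
    ((hilbTangentLineMap X ι₀ π hI aug hπ i).hom.app (op V)).hom s + ((hilbTangentLineMap X ι₀ π hI aug hπ i').hom.app (op V)).hom s
  -- `s = H(ε ↦ ε) v` for `v = H((ε ↦ ε)⁻¹) s`
  let e := ArtAlg.sqZeroKerLineEquiv (ArtAlg.sqZeroExtAug (k := k) k) (ArtAlg.ker_sqZeroExtAug_mul_maximalIdeal k)
    (ArtAlg.epsKer k) (ArtAlg.epsKer_ne_zero k) (ArtAlg.exists_eq_smul_epsKer k)
  have hs : s = F.map (R := ArtAlg.sqZeroExt (k := k) k)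
      (S := ArtAlg.sqZeroKer (ArtAlg.sqZeroExtAug (k := k) k) (ArtAlg.ker_sqZeroExtAug_mul_maximalIdeal k))
      (ArtAlg.sqZeroKerLine (ArtAlg.sqZeroExtAug (k := k) k) (ArtAlg.ker_sqZeroExtAug_mul_maximalIdeal k) (ArtAlg.epsKer k))
      (F.map (R := ArtAlg.sqZeroKer (ArtAlg.sqZeroExtAug (k := k) k) (ArtAlg.ker_sqZeroExtAug_mul_maximalIdeal k))
        (S := ArtAlg.sqZeroExt (k := k) k) (e.symm : _ →ₐ[k] _) s) := by
    rw [← ArtAlg.sqZeroKerLineEquiv_toAlgHom _ _ (ArtAlg.epsKer k) (ArtAlg.epsKer_ne_zero k) (ArtAlg.exists_eq_smul_epsKer k),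
      ← ArtinFunctor.map_comp, AlgEquiv.comp_symm, ArtinFunctor.map_id]
  rw [hs, hilbTangentLineMap_app_map_sqZeroKerLine, hilbTangentLineMap_app_map_sqZeroKerLine,
    hilbTangentLineMap_app_map_sqZeroKerLine, ← ArtinFunctor.kerTensorEquiv_tmul F _ hpt h2 π hI aug,
    ← ArtinFunctor.kerTensorEquiv_tmul F _ hpt h2 π hI aug, ← ArtinFunctor.kerTensorEquiv_tmul F _ hpt h2 π hI aug,
    TensorProduct.tmul_add, map_add]

/-- `μ_0 = 0`. [cite: Schlessinger1968, (2.17), p. 213] -/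
theorem hilbTangentLineMap_zero : hilbTangentLineMap X ι₀ π hI aug hπ 0 = 0 := by
  have h := hilbTangentLineMap_add X ι₀ π hI aug hπ 0 0
  rw [add_zero] at h
  exact left_eq_add.mp h

/-- **`i ↦ μ_i` as a homomorphism `J →+ Hom(T_ε, T_π)`**. Definition with body. [cite: Schlessinger1968, (2.17), p. 213] -/
def hilbTangentLineMapAddHom : ↥(ArtAlg.kerSubmodule π) →+ (hilbTangentSheafEps X ι₀ ⟶ hilbTangentSheaf X ι₀ π hI aug) where
  toFun := hilbTangentLineMap X ι₀ π hI aug hπ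
  map_zero' := hilbTangentLineMap_zero X ι₀ π hI aug hπ
  map_add' := hilbTangentLineMap_add X ι₀ π hI aug hπ

/-- Unfolding `hilbTangentLineMapAddHom`. [cite: Schlessinger1968, (2.17), p. 213] -/
theorem hilbTangentLineMapAddHom_apply (i : ↥(ArtAlg.kerSubmodule π)) :
    hilbTangentLineMapAddHom X ι₀ π hI aug hπ i = hilbTangentLineMap X ι₀ π hI aug hπ i :=
  rfl

/-- `μ_{Σ x_l} = Σ μ_{x_l}`. [cite: Schlessinger1968, (2.17), p. 213] -/
theorem hilbTangentLineMap_sum {ι : Type*} (s : Finset ι) (x : ι → ↥(ArtAlg.kerSubmodule π)) :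
    hilbTangentLineMap X ι₀ π hI aug hπ (∑ l ∈ s, x l) = ∑ l ∈ s, hilbTangentLineMap X ι₀ π hI aug hπ (x l) := by
  rw [← hilbTangentLineMapAddHom_apply, map_sum]
  rfl

end Generate

/-! ## §4 Coordinates: `ρ_w = Σ_l ρ_{b_l^*} ≫ (w(b_l) ·)` and `Σ_l ρ_{b_l^*} ≫ ψ_ε⁻¹ ≫ μ_{b_l} = 𝟙` -/

section Coordinates

variable {k : Type u} [Field k] (X : Motives.SchemeOver k) {Z : Scheme.{u}} (ι₀ : Z ⟶ X.left) [IsClosedImmersion ι₀]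
  [IsLocallyNoetherian X.left]
  {A' A : ArtAlg.{u} k} (π : A' →ₐ[k] A) (hI : RingHom.ker π * maximalIdeal A' = ⊥) (aug : ↥A' →ₐ[k] k)
  (hπ : Function.Surjective π) {ι : Type*} [Fintype ι] (b : Module.Basis ι k ↥(ArtAlg.kerSubmodule π))

omit [Fintype ι] in
/-- `b_l^*(b_l) = 1`. [folklore] -/
private theorem coord_self (l : ι) : b.coord l (b l) = 1 := by
  rw [Module.Basis.coord_apply, Module.Basis.repr_self, Finsupp.single_eq_same]

omit [IsClosedImmersion ι₀] [IsLocallyNoetherian X.left] in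
/-- Homotheties of `𝒩_{Z/X}` by global functions multiply (they ARE the ring homomorphism `abScalarRingHom`).
[cite: Hartshorne1977, III Remark 2.6.1, p. 208] -/
private theorem normalSheafAbScalar_comp (a a' : Γ(Z, ⊤)) :
    normalSheafAbScalar ι₀ a ≫ normalSheafAbScalar ι₀ a' = normalSheafAbScalar ι₀ (a' * a) := by
  change abScalarRingHom (HodgeTheory.normalSheaf ι₀) a' * abScalarRingHom (HodgeTheory.normalSheaf ι₀) a =
    abScalarRingHom (HodgeTheory.normalSheaf ι₀) (a' * a)
  rw [map_mul]

omit [IsClosedImmersion ι₀] [IsLocallyNoetherian X.left] in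
/-- … and add. [cite: Hartshorne1977, III Remark 2.6.1, p. 208] -/
private theorem normalSheafAbScalar_sum {J : Type*} (s : Finset J) (a : J → Γ(Z, ⊤)) :
    ∑ j ∈ s, normalSheafAbScalar ι₀ (a j) = normalSheafAbScalar ι₀ (∑ j ∈ s, a j) := by
  change ∑ j ∈ s, abScalarRingHom (HodgeTheory.normalSheaf ι₀) (a j) = abScalarRingHom (HodgeTheory.normalSheaf ι₀) (∑ j ∈ s, a j)
  rw [map_sum]

/-- **`ρ_w = Σ_l ρ_{b_l^*} ≫ (w(b_l) ·)`** for any functional `w` with `w t = 1` and any basis `(b_l)` of `J`: both sides read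
the line `μ_i` as the scalar `w(i) = Σ_l b_l^*(i) w(b_l)` (§2), and the lines generate (§3). This is the statement that the
`ρ_{b_l^*}` are the coordinates of `T_π ≅ 𝒩_{Z/X} ⊗_k J` against the basis `(b_l)`: every probe factors through them linearly.
[cite: Hartshorne2010, §11 Definition (b), p. 96] [cite: Schlessinger1968, Lemma 2.10 and (2.17), pp. 212–213] -/
theorem hilbTangentProbe_eq_sum (w : ↥(ArtAlg.kerSubmodule π) →ₗ[k] k) (t : ↥(ArtAlg.kerSubmodule π)) (ht : w t = 1) :
    hilbTangentProbe X ι₀ π hI aug hπ w t ht =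
      ∑ l, hilbTangentProbe X ι₀ π hI aug hπ (b.coord l) (b l) (coord_self π b l) ≫
        normalSheafAbScalar ι₀ (subschemeScalar X ι₀ (w (b l))) := by
  refine hilbTangentSheaf.hom_ext_lineMap X ι₀ π hI aug hπ fun i => ?_
  have hw : w i = ∑ l, w (b l) * b.coord l i := by
    conv_lhs => rw [← b.sum_repr i]
    rw [map_sum]
    refine Finset.sum_congr rfl fun l _ => ?_
    rw [map_smul, smul_eq_mul, Module.Basis.coord_apply, mul_comm]
  rw [hilbTangentLineMap_comp_hilbTangentProbe X ι₀ π hI aug hπ w t ht i, Preadditive.comp_sum, hw,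
    show subschemeScalar X ι₀ (∑ l, w (b l) * b.coord l i) = ∑ l, subschemeScalar X ι₀ (w (b l) * b.coord l i) from
      map_sum (scalarRingHomTop (subschemeOver X ι₀)) _ _,
    ← normalSheafAbScalar_sum, Preadditive.comp_sum]
  refine Finset.sum_congr rfl fun l _ => ?_
  rw [← Category.assoc, hilbTangentLineMap_comp_hilbTangentProbe X ι₀ π hI aug hπ (b.coord l) (b l) (coord_self π b l) i,
    Category.assoc, normalSheafAbScalar_comp]
  exact congrArg (fun a => (hilbTangentNormalIsoEps X ι₀).hom ≫ normalSheafAbScalar ι₀ a)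
    (map_mul (scalarRingHomTop (subschemeOver X ι₀)) _ _)

/-- `ψ_ε ≫ (c ·) ≫ ψ_ε⁻¹ ≫ f = T_{σ_c} ≫ f`. [cite: Schlessinger1968, Lemma 2.10, p. 212] -/
theorem hilbTangentNormalIsoEps_hom_comp_scalar_comp_inv_comp {G : Sheaf (Opens.grothendieckTopology Z) AddCommGrpCat.{u}}
    (c : k) (f : hilbTangentSheafEps X ι₀ ⟶ G) :
    (hilbTangentNormalIsoEps X ι₀).hom ≫ normalSheafAbScalar ι₀ (subschemeScalar X ι₀ c) ≫ (hilbTangentNormalIsoEps X ι₀).inv ≫ f =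
      hilbTangentEpsScale X ι₀ c ≫ f := by
  rw [← hilbTangentNormalIsoEps_hom_comp_scalar_comp_inv, Category.assoc, Category.assoc]

/-- **`Σ_l ρ_{b_l^*} ≫ ψ_ε⁻¹ ≫ μ_{b_l} = 𝟙_{T_π}`**: the coordinates `ρ_{b_l^*} : T_π ⟶ 𝒩_{Z/X}` and the lines
`ψ_ε⁻¹ ≫ μ_{b_l} : 𝒩_{Z/X} ⟶ T_π` split `T_π` as `⊕_l 𝒩_{Z/X} = 𝒩_{Z/X} ⊗_k J` — on the line `μ_i` the left side is
`Σ_l T_{σ_{b_l^*(i)}} ≫ μ_{b_l} = μ_{Σ b_l^*(i) b_l} = μ_i` (§2, §3). [cite: Hartshorne2010, Thm. 6.2 (a)–(b), p. 47 («`𝒩₀ ⊗_k J`»)]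
[cite: Schlessinger1968, Lemma 2.10 and (2.17), pp. 212–213] -/
theorem sum_hilbTangentProbe_comp_inv_comp_lineMap :
    ∑ l, hilbTangentProbe X ι₀ π hI aug hπ (b.coord l) (b l) (coord_self π b l) ≫ (hilbTangentNormalIsoEps X ι₀).inv ≫
        hilbTangentLineMap X ι₀ π hI aug hπ (b l) =
      𝟙 (hilbTangentSheaf X ι₀ π hI aug) := by
  refine hilbTangentSheaf.hom_ext_lineMap X ι₀ π hI aug hπ fun i => ?_
  have hterm : ∀ l, hilbTangentLineMap X ι₀ π hI aug hπ i ≫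
      (hilbTangentProbe X ι₀ π hI aug hπ (b.coord l) (b l) (coord_self π b l) ≫ (hilbTangentNormalIsoEps X ι₀).inv ≫
        hilbTangentLineMap X ι₀ π hI aug hπ (b l)) =
      hilbTangentLineMap X ι₀ π hI aug hπ (b.coord l i • b l) := fun l => by
    rw [← Category.assoc, hilbTangentLineMap_comp_hilbTangentProbe X ι₀ π hI aug hπ (b.coord l) (b l) (coord_self π b l) i,
      Category.assoc, hilbTangentNormalIsoEps_hom_comp_scalar_comp_inv_comp, ← hilbTangentLineMap_smul]
  rw [Preadditive.comp_sum, Category.comp_id, Finset.sum_congr rfl fun l _ => hterm l, ← hilbTangentLineMap_sum]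
  congr 1
  conv_rhs => rw [← b.sum_repr i]
  refine Finset.sum_congr rfl fun l _ => ?_
  rw [Module.Basis.coord_apply]

end Coordinates

end Literature.AlgebraicGeometry.Deformation
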